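import Summits.BirchSwinnertonDyer.BirchSwinnertonDyer.Theorems.ByReductionTypeAtTwoTowerKerTwoTorsion
import Summits.BirchSwinnertonDyer.BirchSwinnertonDyer.Theorems.ByReductionTypeAtTwoTowerTorsionCertificateFrobenius
import HarnessLib

/-!
# The certificate `#E(ℚ_∞)[2] ≤ 2` from ONE Frobenius prime `ℓ ≡ ±1 (mod 8)` at which the resolvent
# discriminant `s` is a non-residue — the `hinf` input of the `ℤ/4`-tolerant gap and rank doors
# (route ByReductionTypeAtTwo, items 19577 / 19573; seat bsd-2adic-ord-3 GEN 7)

HONEST FRAMING (cell `bsd-2adic`, run/shared/lean/pub/bsd-2adic/, HUMAN RULINGS D-0036 / D-0054 / D-0074): THEOREMS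
ONLY; nothing asserted; no definition; no named fact; closes nothing by itself.

THE ARGUMENT. `W/ℚ` has a rational `2`-torsion abscissa `e₁`; the other two `2`-division abscissae are the roots
of the quadratic cofactor `4X² + BX + C` (`B = b₂ + 4e₁`, `C = 2b₄ + b₂e₁ + 4e₁²`, discriminant `s = B² − 16C`).
(§1) Every `σ ∈ Γ_ℚ` permutes these two roots, so `σ²` fixes EVERY point of `E[2]`. (§2) `Gal(K̄/ℚ_1) =
κ⁻¹(2ℤ₂)` consists of products `k·τ²` with `k ∈ Gal(ℚ̄/ℚ_∞) = ker κ` (`κ` is onto `ℤ₂`), so every point of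
`E(ℚ_∞)[2] = E[2]^{ker κ}` is fixed by all of `Gal(ℚ̄/ℚ_1)` — «the only quadratic subfield of `ℚ_∞` is
`ℚ_1 = ℚ(√2)`». (§3) A Frobenius `σ₀` at `ℓ` with `1 + 3 ≤ v₂(ℓ² − 1)` lies in `Gal(ℚ̄/ℚ_1)` (tower-1's norm
formula, GEN 6 `exists_mem_layerSubgroup_apply_ne`) and moves `√s` when `ℓ ∣ s^{⌊ℓ/2⌋} + 1` (Euler), hence fixes
no `2`-torsion point off `x = e₁` (GEN 6 step (i)); so `E(ℚ_∞)[2] ⊆ {O, T}`: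
**`#{b ∈ E(ℚ_∞)[2^∞] : 2b = 0} ≤ 2^1`** from THREE decidable facts (`2^4 ∣ ℓ² − 1`, `ℓ ∣ s^{⌊ℓ/2⌋} + 1`, `ψ₂(e₁) = 0`).
With `…TowerKerTwoTorsion` this is the torsion input `t = 1` of the gap / rank doors on the `ℤ/4` classes
(299775b, 354603d, 88723d), where `#E(ℚ)[2^∞] = 4` made the old doors charge `t = 2`.
References: [SilvermanAEC2009] III.2.3 (d), VIII.§1; [Washington1997] §13.1; [IrelandRosen1990] Prop. 5.1.1;
[GreenbergLNM1716] §3 Lemma 3.1, §4 Lemma 4.3.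
-/

set_option autoImplicit false
-- the sub-problem namespace repeats the summit name by design (D-0017 nested layout)
set_option linter.dupNamespace false

noncomputable section

open scoped Classical

open Polynomial NumberField IsDedekindDomain WeierstrassCurve Literature.NumberTheory.EllipticCurves
  Rat.HeightOneSpectrum

namespace Summit.BirchSwinnertonDyer.BirchSwinnertonDyer.Theorems.TowerLambdaTorsion

section Galois

variable (W : WeierstrassCurve ℚ)

/-- Two points of order dividing `2` with the same abscissa are equal (`y` is forced: `2y = −a₁x − a₃`). [folklore] -/
theorem some_eq_some_of_add_self_eq_zero {x x' y y' : AlgebraicClosure ℚ}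
    {h : (W.baseChange (AlgebraicClosure ℚ)).toAffine.Nonsingular x y}
    {h' : (W.baseChange (AlgebraicClosure ℚ)).toAffine.Nonsingular x' y'} (hx : x' = x)
    (h2' : Affine.Point.some x' y' h' + Affine.Point.some x' y' h' = 0)
    (h2 : Affine.Point.some x y h + Affine.Point.some x y h = 0) :
    Affine.Point.some x' y' h' = Affine.Point.some x y h := by
  subst hx
  obtain ⟨hy, -⟩ := (W.baseChange (AlgebraicClosure ℚ)).isRoot_twoTorsionPolynomial_of_add_self_eq_zero h2
  obtain ⟨hy', -⟩ := (W.baseChange (AlgebraicClosure ℚ)).isRoot_twoTorsionPolynomial_of_add_self_eq_zero h2'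
  have hyy : y' = y := by
    change y = -y - (W.baseChange (AlgebraicClosure ℚ)).a₁ * x' - (W.baseChange (AlgebraicClosure ℚ)).a₃ at hy
    change y' = -y' - (W.baseChange (AlgebraicClosure ℚ)).a₁ * x' - (W.baseChange (AlgebraicClosure ℚ)).a₃ at hy'
    have h2z : (2 : AlgebraicClosure ℚ) * (y' - y) = 0 := by linear_combination hy' - hy
    exact sub_eq_zero.mp ((mul_eq_zero.mp h2z).resolve_left two_ne_zero)
  subst hyy
  rfl

/-- **`σ²` fixes `E[2]` pointwise** when `W` has a rational `2`-torsion abscissa `e₁`: `σ` permutes the two roots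
of the quadratic cofactor of the `2`-division cubic. [cite: SilvermanAEC2009, III.2.3 (d), VIII.§1] -/
theorem smul_smul_eq_self_of_two_torsion (σ : Field.absoluteGaloisGroup ℚ) (e₁ : ℚ)
    (he₁ : 4 * e₁ ^ 3 + W.b₂ * e₁ ^ 2 + 2 * W.b₄ * e₁ + W.b₆ = 0)
    {m : geomPrimaryTorsion W 2} (h2 : 2 • m = 0) : σ • (σ • m) = m := by
  by_cases hm0 : m = 0
  · rw [hm0, smul_zero, smul_zero]
  set Kb := AlgebraicClosure ℚ
  let σ' : Kb ≃ₐ[ℚ] Kb := σ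
  set V : WeierstrassCurve Kb := W.baseChange Kb with hVdef
  set E₁ : Kb := algebraMap ℚ Kb e₁ with hE₁
  have hVb₂ : V.b₂ = algebraMap ℚ Kb W.b₂ := by rw [hVdef, WeierstrassCurve.baseChange, map_b₂]
  have hVb₄ : V.b₄ = algebraMap ℚ Kb W.b₄ := by rw [hVdef, WeierstrassCurve.baseChange, map_b₄]
  have hVb₆ : V.b₆ = algebraMap ℚ Kb W.b₆ := by rw [hVdef, WeierstrassCurve.baseChange, map_b₆]
  have he₁K : 4 * E₁ ^ 3 + V.b₂ * E₁ ^ 2 + 2 * V.b₄ * E₁ + V.b₆ = 0 := by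
    have h := congrArg (algebraMap ℚ Kb) he₁
    rw [map_zero] at h
    rw [← h, hVb₂, hVb₄, hVb₆, hE₁]
    simp only [map_add, map_mul, map_pow, map_ofNat]
  have hact : ∀ P : geomPoints W, σ • P = Affine.Point.map (σ' : Kb →ₐ[ℚ] Kb) P := fun P ↦ rfl
  -- coordinates of `m`
  have hm0' : (m : geomPoints W) ≠ 0 := fun h ↦ hm0 (Subtype.ext h)
  obtain ⟨x, y, h, hmeq⟩ := exists_eq_some_of_ne_zero W (K := Kb) hm0'
  have h2m : (m : geomPoints W) + (m : geomPoints W) = 0 := by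
    have := congrArg (fun z : geomPrimaryTorsion W 2 ↦ (z : geomPoints W)) h2
    simp only [ZeroMemClass.coe_zero, two_nsmul] at this
    exact this
  have h2' : Affine.Point.some x y h + Affine.Point.some x y h = 0 := by rwa [hmeq] at h2m
  obtain ⟨-, hroot⟩ := V.isRoot_twoTorsionPolynomial_of_add_self_eq_zero h2'
  have hg : 4 * x ^ 3 + V.b₂ * x ^ 2 + 2 * V.b₄ * x + V.b₆ = 0 := by
    simpa only [twoTorsionPolynomial, Cubic.toPoly, IsRoot.def, eval_add, eval_mul, eval_C, eval_pow,
      eval_X] using hroot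
  -- `σ'(σ' x) = x`
  have hB : σ' (V.b₂ + 4 * E₁) = V.b₂ + 4 * E₁ := by
    rw [hVb₂, hE₁]; simp only [map_add, map_mul, map_ofNat, AlgEquiv.commutes]
  have hC : σ' (2 * V.b₄ + V.b₂ * E₁ + 4 * E₁ ^ 2) = 2 * V.b₄ + V.b₂ * E₁ + 4 * E₁ ^ 2 := by
    rw [hVb₂, hVb₄, hE₁]; simp only [map_add, map_mul, map_pow, map_ofNat, AlgEquiv.commutes]
  have hxx : σ' (σ' x) = x := by
    by_cases hxe : x = E₁
    · rw [hxe, hE₁, AlgEquiv.commutes, AlgEquiv.commutes]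
    · have hfac := twoTorsionCubic_sub_eq_mul V.b₂ V.b₄ V.b₆ E₁ x
      rw [hg, he₁K, sub_zero] at hfac
      have hquad : 4 * x ^ 2 + (V.b₂ + 4 * E₁) * x + (2 * V.b₄ + V.b₂ * E₁ + 4 * E₁ ^ 2) = 0 := by
        rcases mul_eq_zero.mp hfac.symm with h0 | h0
        · exact absurd (sub_eq_zero.mp h0) hxe
        · exact h0
      have hquad' : 4 * (σ' x) ^ 2 + (V.b₂ + 4 * E₁) * σ' x + (2 * V.b₄ + V.b₂ * E₁ + 4 * E₁ ^ 2) = 0 := by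
        have h := congrArg σ' hquad
        rw [map_zero] at h
        rw [← h]
        simp only [map_add, map_mul, map_pow, map_ofNat, hB, hC]
      -- the two roots: `σ' x = x` or `4 σ' x = −4x − B`
      have hdiff : (x - σ' x) * (4 * (x + σ' x) + (V.b₂ + 4 * E₁)) = 0 := by
        linear_combination hquad - hquad'
      rcases mul_eq_zero.mp hdiff with h0 | h0
      · rw [← sub_eq_zero.mp h0, ← sub_eq_zero.mp h0]
      · have h0' : 4 * (σ' x + σ' (σ' x)) + (V.b₂ + 4 * E₁) = 0 := by
          have h := congrArg σ' h0
          rw [map_zero] at h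
          rw [← h]
          simp only [map_add, map_mul, map_ofNat, hB]
        have h4 : (4 : Kb) * (σ' (σ' x) - x) = 0 := by linear_combination h0' - h0
        exact sub_eq_zero.mp ((mul_eq_zero.mp h4).resolve_left (by norm_num))
  -- `σσm` is a `2`-torsion point with abscissa `σ'σ'x = x`, hence `= m`
  have hP2 : Affine.Point.map (σ' : Kb →ₐ[ℚ] Kb) (Affine.Point.map (σ' : Kb →ₐ[ℚ] Kb) (Affine.Point.some x y h)) +
      Affine.Point.map (σ' : Kb →ₐ[ℚ] Kb) (Affine.Point.map (σ' : Kb →ₐ[ℚ] Kb) (Affine.Point.some x y h)) = 0 := by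
    rw [← map_add, ← map_add, h2', map_zero, map_zero]
  have main : Affine.Point.map (σ' : Kb →ₐ[ℚ] Kb) (Affine.Point.map (σ' : Kb →ₐ[ℚ] Kb) (Affine.Point.some x y h)) =
      Affine.Point.some x y h := by
    simp only [Affine.Point.map_some] at hP2 ⊢
    exact some_eq_some_of_add_self_eq_zero W hxx hP2 h2'
  apply Subtype.ext
  rw [primaryComponent.coe_smul, primaryComponent.coe_smul, hact, hact, hmeq]
  exact main

/-- **`Gal(ℚ̄/ℚ_1)` fixes `E(ℚ_∞)[2]` pointwise**: an element of `κ.layerSubgroup 1 = κ⁻¹(2ℤ₂)` is `k·τ²`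
with `k ∈ ker κ` (`κ` onto `ℤ₂`), `k` fixes `E(ℚ_∞)[2^∞]` and `τ²` fixes `E[2]`
(`smul_smul_eq_self_of_two_torsion`). [cite: Washington1997, §13.1] [cite: SilvermanAEC2009, VIII.§1] -/
theorem smul_eq_self_of_mem_layerSubgroup_one (κ : ZpExtension ℚ 2) (e₁ : ℚ)
    (he₁ : 4 * e₁ ^ 3 + W.b₂ * e₁ ^ 2 + 2 * W.b₄ * e₁ + W.b₆ = 0)
    {σ : Field.absoluteGaloisGroup ℚ} (hσ : σ ∈ κ.layerSubgroup 1)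
    (b : FixedPoints.addSubgroup κ.kerSubgroup (geomPrimaryTorsion W 2))
    (h2 : 2 • (b : geomPrimaryTorsion W 2) = 0) :
    σ • (b : geomPrimaryTorsion W 2) = b := by
  obtain ⟨y, hy⟩ := ZpExtension.mem_layerSubgroup.mp hσ
  obtain ⟨τ, hτ⟩ := κ.surjective (Multiplicative.ofAdd y)
  have hτ' : κ τ = Multiplicative.ofAdd y := hτ
  have hκσ : κ σ = κ (τ * τ) := by
    rw [map_mul, hτ']
    apply Multiplicative.toAdd.injective
    rw [hy, toAdd_mul, toAdd_ofAdd, pow_one]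
    push_cast
    ring
  have hk : σ * (τ * τ)⁻¹ ∈ κ.kerSubgroup := by
    rw [ZpExtension.mem_kerSubgroup, map_mul, map_inv, hκσ, mul_inv_cancel]
  have hkfix : (σ * (τ * τ)⁻¹) • (b : geomPrimaryTorsion W 2) = b := by
    have hb2 := b.2
    rw [FixedPoints.mem_addSubgroup] at hb2
    have := hb2 ⟨σ * (τ * τ)⁻¹, hk⟩
    rwa [Subgroup.mk_smul] at this
  have hdecomp : σ = σ * (τ * τ)⁻¹ * τ * τ := by group
  calc σ • (b : geomPrimaryTorsion W 2)
      = (σ * (τ * τ)⁻¹ * τ * τ) • (b : geomPrimaryTorsion W 2) := by rw [← hdecomp]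
    _ = (σ * (τ * τ)⁻¹) • (τ • (τ • (b : geomPrimaryTorsion W 2))) := by rw [mul_smul, mul_smul]
    _ = b := by rw [smul_smul_eq_self_of_two_torsion W τ e₁ he₁ h2, hkfix]

/-- **A Galois element moving `√s` fixes no `2`-torsion point off `{O, T}`**: two nonzero `σ`-fixed points of
order `2` coincide (GEN 6's step (i): a fixed `2`-torsion point with `x ≠ e₁` makes `8x + B` a fixed square root
of `s`). [cite: SilvermanAEC2009, III.2.3 (d), VIII.§1] -/
theorem eq_of_two_torsion_of_smul_eq (σ : Field.absoluteGaloisGroup ℚ) (e₁ s : ℚ)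
    (he₁ : 4 * e₁ ^ 3 + W.b₂ * e₁ ^ 2 + 2 * W.b₄ * e₁ + W.b₆ = 0)
    (hs : s = (W.b₂ + 4 * e₁) ^ 2 - 16 * (2 * W.b₄ + W.b₂ * e₁ + 4 * e₁ ^ 2))
    (hσs : ∀ β : AlgebraicClosure ℚ, β ^ 2 = algebraMap ℚ (AlgebraicClosure ℚ) s →
      (show AlgebraicClosure ℚ ≃ₐ[ℚ] AlgebraicClosure ℚ from σ) β ≠ β)
    {m m' : geomPrimaryTorsion W 2} (h2m : 2 • m = 0) (hm : σ • m = m) (hm0 : m ≠ 0)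
    (h2m' : 2 • m' = 0) (hm' : σ • m' = m') (hm0' : m' ≠ 0) : m = m' := by
  set Kb := AlgebraicClosure ℚ
  set σ' : Kb ≃ₐ[ℚ] Kb := σ with hσ'
  set V : WeierstrassCurve Kb := W.baseChange Kb with hVdef
  set E₁ : Kb := algebraMap ℚ Kb e₁ with hE₁
  have hVb₂ : V.b₂ = algebraMap ℚ Kb W.b₂ := by rw [hVdef, WeierstrassCurve.baseChange, map_b₂]
  have hVb₄ : V.b₄ = algebraMap ℚ Kb W.b₄ := by rw [hVdef, WeierstrassCurve.baseChange, map_b₄]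
  have hVb₆ : V.b₆ = algebraMap ℚ Kb W.b₆ := by rw [hVdef, WeierstrassCurve.baseChange, map_b₆]
  have he₁K : 4 * E₁ ^ 3 + V.b₂ * E₁ ^ 2 + 2 * V.b₄ * E₁ + V.b₆ = 0 := by
    have h := congrArg (algebraMap ℚ Kb) he₁
    rw [map_zero] at h
    rw [← h, hVb₂, hVb₄, hVb₆, hE₁]
    simp only [map_add, map_mul, map_pow, map_ofNat]
  have hsK : algebraMap ℚ Kb s = (V.b₂ + 4 * E₁) ^ 2 - 16 * (2 * V.b₄ + V.b₂ * E₁ + 4 * E₁ ^ 2) := by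
    rw [hs, hVb₂, hVb₄, hE₁]
    simp only [map_add, map_sub, map_mul, map_pow, map_ofNat]
  have hact : ∀ P : geomPoints W, σ • P = Affine.Point.map (σ' : Kb →ₐ[ℚ] Kb) P := fun P ↦ rfl
  -- STEP (i) of GEN 6: a nonzero `σ`-fixed `2`-torsion point has `x = e₁`
  have step_i : ∀ {x y : Kb} {h : V.toAffine.Nonsingular x y},
      Affine.Point.map (σ' : Kb →ₐ[ℚ] Kb) (Affine.Point.some x y h) = Affine.Point.some x y h →
      Affine.Point.some x y h + Affine.Point.some x y h = 0 → x = E₁ := by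
    intro x y h hfix h2
    obtain ⟨-, hroot⟩ := V.isRoot_twoTorsionPolynomial_of_add_self_eq_zero h2
    have hg : 4 * x ^ 3 + V.b₂ * x ^ 2 + 2 * V.b₄ * x + V.b₆ = 0 := by
      simpa only [twoTorsionPolynomial, Cubic.toPoly, IsRoot.def, eval_add, eval_mul, eval_C, eval_pow,
        eval_X] using hroot
    have hσx : σ' x = x := algEquiv_x_eq_of_map_eq W σ' hfix
    by_contra hne
    have hfac := twoTorsionCubic_sub_eq_mul V.b₂ V.b₄ V.b₆ E₁ x
    rw [hg, he₁K, sub_zero] at hfac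
    have hquad : 4 * x ^ 2 + (V.b₂ + 4 * E₁) * x + (2 * V.b₄ + V.b₂ * E₁ + 4 * E₁ ^ 2) = 0 := by
      rcases mul_eq_zero.mp hfac.symm with h0 | h0
      · exact absurd (sub_eq_zero.mp h0) hne
      · exact h0
    have hβ := sq_eq_disc_of_quadratic_eq_zero hquad
    refine hσs (8 * x + (V.b₂ + 4 * E₁)) (by rw [hβ, hsK]) ?_
    change σ' (8 * x + (V.b₂ + 4 * E₁)) = 8 * x + (V.b₂ + 4 * E₁)
    rw [hVb₂, hE₁]
    simp only [map_add, map_mul, map_ofNat, hσx, AlgEquiv.commutes]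
  -- coordinates of `m`, `m'`
  have key : ∀ {m : geomPrimaryTorsion W 2}, 2 • m = 0 → σ • m = m → m ≠ 0 →
      ∃ (y : Kb) (h : V.toAffine.Nonsingular E₁ y),
        (m : geomPoints W) = Affine.Point.some E₁ y h ∧
          (Affine.Point.some E₁ y h + Affine.Point.some E₁ y h = 0) := by
    intro m h2 hfix hm0
    have hm0' : (m : geomPoints W) ≠ 0 := fun h ↦ hm0 (Subtype.ext h)
    obtain ⟨x, y, h, hmeq⟩ := exists_eq_some_of_ne_zero W (K := Kb) hm0'
    have h2' : (m : geomPoints W) + (m : geomPoints W) = 0 := by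
      have := congrArg (fun z : geomPrimaryTorsion W 2 ↦ (z : geomPoints W)) h2
      simp only [ZeroMemClass.coe_zero, two_nsmul] at this
      exact this
    have hfix' : σ • (m : geomPoints W) = m := by rw [← primaryComponent.coe_smul, hfix]
    rw [hmeq, hact] at hfix'
    rw [hmeq] at h2'
    have hx := step_i hfix' h2'
    subst hx
    exact ⟨y, h, hmeq, h2'⟩
  obtain ⟨y, h, hmeq, h2⟩ := key h2m hm hm0
  obtain ⟨y', h', hmeq', h2'⟩ := key h2m' hm' hm0'
  apply Subtype.ext
  rw [hmeq, hmeq']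
  exact some_eq_some_of_add_self_eq_zero W rfl h2 h2'

/-! ## §3 The certificate -/

/-- **`#E(ℚ_∞)[2] ≤ 2^1` from one Galois element**: if some `σ ∈ κ.layerSubgroup 1` fixes no square root of the
resolvent discriminant `s` (with `e₁` a rational `2`-torsion abscissa), then at most two points `b` of
`E(ℚ_∞)[2^∞] = E[2^∞]^{ker κ}` have `2b = 0`. [cite: SilvermanAEC2009, III.2.3 (d), VIII.§1] [cite: Washington1997, §13.1] -/
theorem natCard_infTwoTorsion_le_two {κ : ZpExtension ℚ 2} (σ : Field.absoluteGaloisGroup ℚ)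
    (hσ : σ ∈ κ.layerSubgroup 1) (e₁ s : ℚ)
    (he₁ : 4 * e₁ ^ 3 + W.b₂ * e₁ ^ 2 + 2 * W.b₄ * e₁ + W.b₆ = 0)
    (hs : s = (W.b₂ + 4 * e₁) ^ 2 - 16 * (2 * W.b₄ + W.b₂ * e₁ + 4 * e₁ ^ 2))
    (hσs : ∀ β : AlgebraicClosure ℚ, β ^ 2 = algebraMap ℚ (AlgebraicClosure ℚ) s →
      (show AlgebraicClosure ℚ ≃ₐ[ℚ] AlgebraicClosure ℚ from σ) β ≠ β) :
    Nat.card {b : FixedPoints.addSubgroup κ.kerSubgroup (geomPrimaryTorsion W 2) // 2 • b = 0} ≤ 2 ^ 1 := by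
  rw [pow_one]
  let f : {b : FixedPoints.addSubgroup κ.kerSubgroup (geomPrimaryTorsion W 2) // 2 • b = 0} → Bool :=
    fun b ↦ decide (b.1 = 0)
  have h2c : ∀ b : {b : FixedPoints.addSubgroup κ.kerSubgroup (geomPrimaryTorsion W 2) // 2 • b = 0},
      2 • (b.1 : geomPrimaryTorsion W 2) = 0 := fun b ↦ by
    have h := congrArg (fun z : FixedPoints.addSubgroup κ.kerSubgroup (geomPrimaryTorsion W 2) ↦
      (z : geomPrimaryTorsion W 2)) b.2
    simp only [AddSubgroupClass.coe_nsmul, ZeroMemClass.coe_zero] at h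
    exact h
  have hf : Function.Injective f := by
    intro a b hab
    have hab' : (a.1 = 0 ↔ b.1 = 0) := by simpa [f] using hab
    by_cases ha : a.1 = 0
    · exact Subtype.ext (ha.trans (hab'.mp ha).symm)
    · have hb : b.1 ≠ 0 := fun hb ↦ ha (hab'.mpr hb)
      have ha' : (a.1 : geomPrimaryTorsion W 2) ≠ 0 := fun h ↦ ha (Subtype.ext h)
      have hb' : (b.1 : geomPrimaryTorsion W 2) ≠ 0 := fun h ↦ hb (Subtype.ext h)
      exact Subtype.ext (Subtype.ext (eq_of_two_torsion_of_smul_eq W σ e₁ s he₁ hs hσs (h2c a)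
        (smul_eq_self_of_mem_layerSubgroup_one W κ e₁ he₁ hσ a.1 (h2c a)) ha' (h2c b)
        (smul_eq_self_of_mem_layerSubgroup_one W κ e₁ he₁ hσ b.1 (h2c b)) hb'))
  simpa using Nat.card_le_card_of_injective f hf

/-- **`#E(ℚ_∞)[2] ≤ 2^1` from ONE odd prime `ℓ`** with `1 + 3 ≤ v₂(ℓ² − 1)` (`ℓ ≡ ±1 (mod 8)`) and
`ℓ ∣ s^{⌊ℓ/2⌋} + 1` (`s` the INTEGER resolvent discriminant at the rational `2`-torsion abscissa `e₁`): a Frobenius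
at `ℓ` lies in `Gal(ℚ̄/ℚ_1)` and moves `√s`. Valid at every torsion structure (`ℤ/2`, `ℤ/4`, …, not `(ℤ/2)²`);
the `hinf` input (`t = 1`) of `TowerClass.towerGapAtTwo_of_classCounts_of_infTwoTorsion` and
`TowerLambdaTorsion.towerRank_of_layerClasses_of_infTwoTorsion`.
[cite: SilvermanAEC2009, III.2.3 (d), VIII.§1] [cite: Washington1997, §13.1] [cite: IrelandRosen1990, Prop. 5.1.1] -/
theorem natCard_infTwoTorsion_le_two_of_prime (W : WeierstrassCurve ℚ) {κ : ZpExtension ℚ 2}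
    (hκ : κ.IsCyclotomic) (v : HeightOneSpectrum (𝓞 ℚ)) {ℓ : ℕ} (hv : natGenerator v = ℓ)
    (hℓ2 : ℓ ≠ 2) (h8 : 1 + 3 ≤ padicValNat 2 (ℓ ^ 2 - 1)) (e₁ : ℚ) (s : ℤ)
    (he₁ : 4 * e₁ ^ 3 + W.b₂ * e₁ ^ 2 + 2 * W.b₄ * e₁ + W.b₆ = 0)
    (hs : (s : ℚ) = (W.b₂ + 4 * e₁) ^ 2 - 16 * (2 * W.b₄ + W.b₂ * e₁ + 4 * e₁ ^ 2))
    (hsE : (ℓ : ℤ) ∣ s ^ (ℓ / 2) + 1) :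
    Nat.card {b : FixedPoints.addSubgroup κ.kerSubgroup (geomPrimaryTorsion W 2) // 2 • b = 0} ≤ 2 ^ 1 := by
  obtain ⟨σ, hσ, hσs, -⟩ := exists_mem_layerSubgroup_apply_ne hκ v hv hℓ2 h8 hsE hsE
  exact natCard_infTwoTorsion_le_two W σ hσ e₁ s he₁ hs hσs

end Galois

end Summit.BirchSwinnertonDyer.BirchSwinnertonDyer.Theorems.TowerLambdaTorsion

end
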